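import Summits.BirchSwinnertonDyer.Rank1Residual.ManinAdditive.RamanujanCut
import Literature.NumberTheory.EllipticCurves.CuspFormTwist
import HarnessLib
import HarnessLib.Audit.Tags

/-!
# TWIST TRANSPORT of the cut invariants at `3` and the Conway–Norton lattice over `ℤ[ζ₃]` — desc g8 rows
# E-desc-51′ / 52 / 54 (theorem targets), E-desc-51 / 53 / 55 / 56 / 57 (laws) + vocabulary, BY NAME
# (cell `bsd-f2-manin`, descent / visibility lens `bsd-f2-manin-desc` g8, MEMO-desc §25; typing ask T-desc-12; REF1 §R64 GO)

HONEST FRAMING.  LENS = descent / visibility (planner `bsd-f2-manin-desc`, g8; HOME/desc/MEMO-desc.md §25 d3a86ea5a2e27fad,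
HOME/desc/g8/ (SHA16SUMS.desc.g8), source HOME/desc/g8/Sketch-desc-g8.lean 62bec9a36a8efd40, 289 l., farm rc 0 · 0
sorries).  Landed by the cell typer (gen 12) on refuter-1's verdicts (§R64, HOME/ref1/R64-ref1-desc-g7g8.md
47945fc54b95c773, 2026-08-28T12:55Z: g8 — 8 Props + 1 theorem + 2 E-facing predicates ALL SURVIVE / 0 KILLED, BC7 13 / 13
CLEAN summit mode, ENGINE U reproduces the 66 `χ₋₃` pairs and the jump locus; E-desc-52 / 54 THEOREM TARGETS VALID on
paper (54 unconditionally), E-desc-51′ VALID modulo normalisation; E-desc-51 / 53 / 56 / 57 LAWS SURVIVE (57: +2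
out-of-sample); E-desc-55 SURVIVES with scope misread H-1 — REPAIRED HERE: `HasThreeComponentsAtThree` gains the
potentially-good clause of `IsBigStarAtThree`; H-2 level count corrected), everything else VERBATIM (namespace
`…ManinAdditive.ConwayNortonThree` instead of the sketch's `…DescG8`; `[folklore]` tags on plumbing defs).  A sibling
of `RamanujanCut.lean` (desc g5/g6 cut at `3`, 392 l.).  LAND ORDER for the proofs (refuter-1 §R64 R-2, prover / desc
work, NOT done here): E-desc-51′ first as `a_n(B₃ f) = χ₋₃(n) a_n(f)` via `cuspCoeff_charTwist` + RB72.5, then E-desc-54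
(pure `B₃` transport, RB72.7), then E-desc-52 (RB72.10–12 + `D² = −3`); all three by-name, E-blind, no GIVEN rows.

Nothing is asserted: every law is an `@[conjecture] def … : Prop`; the three theorem targets are ALSO tagged
`@[conjecture]` (obligation nodes; E-blind, short paper proofs recorded in MEMO-desc §25, not formalised here; §R64 H-4:
fine).  New objects (tree vocabulary only):

* `thirdTranslate N k j` — the translation `t_{j/3} : f ↦ f(z + j/3)` on `S_k(Γ₀(N))` (`9 ∣ N`), typed exactly like
  `RamanujanCut.ramanujanThree` (which is `t_{1/3} + t_{2/3}`);
* `twistOperatorAtThree N k` — `B₃ := (t_{1/3} − t_{2/3}) / (ζ₃ − ζ₃²) = (t_{1/3} − t_{2/3})/√−3`, acting on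
  `q`-expansions by `aₙ ↦ χ₋₃(n) aₙ` (so `B₃ f = f ⊗ χ₋₃ = charTwist N _ _ _ f`; support target
  `TwistOperatorEqCharTwist` = E-desc-51′ = an's `charTwist N dvd_rfl h9 hχ` on `S₂(Γ₀(N))`, the identity shared with
  an g20 THEOREM A / p628287), and `diagonalOperatorAtThree N k := t_{1/3} − ζ₃ B₃ = A₃`;
* `eisensteinSpan S := S + ζ₃ S` and the **Conway–Norton lattice at 3** `conwayNortonLatticeAtThree N` `=: M^G`: the
  largest `ℤ[ζ₃]`-submodule of `S₂(Γ₀(N);ℤ) ⊗ ℤ[ζ₃]` stable under every `w_{Q_p}` and under `t_{1/3}`;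
* `planeIndex M f` (`= r₀(f)² · 3^{k(f)}` on `M^G`), `eisensteinDepth` (`k(f)`), `translationStableLatticeAtThree N` `=: S^T`;
* E-facing predicates `IsStarredAtThree`, `HasThreeComponentsAtThree` (repaired, H-1).

Census of record (BC5): HOME/desc/g8/out/{tw3.out, tw2.out, t3-N.txt, o3-N.txt, t2-N.txt, bcshift3.txt, pairstats.txt,
t2pairs.txt} (SHA16SUMS.desc.g8), engine `conway_ms_t.py` = MS-0 (`conway_ms.py`, g6 rev 5, read-only) + the T/O cuts;
refuter-1 ENGINE U / U2 / U3 reproductions (§R64).  Refuter-2 placement pending (desc's nulls §25.10; §R64 presearch: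
corpus fts + vec + galaxy — none for twist-(in)variance of cut indices, none for the `27 ∣ N` dichotomy).  bears_on
stmt-BirchSwinnertonDyer-22968 (C3, the Manin constant at `3`: cut side of the `χ₋₃`-transport whose `c`-side is an g20
THEOREM A).  PARTITION 0 · beyond-print theorem: no · BSD is not proved by this; Manin's conjecture is not proved by this.
-/

set_option autoImplicit false

noncomputable section

open scoped MatrixGroups ModularForm

open CongruenceSubgroup WeierstrassCurve Literature.NumberTheory.EllipticCurves.ModularForms
  Literature.NumberTheory.DiophantineGeometry
  Summit.BirchSwinnertonDyer.Rank1Residual.ManinAdditive.RamanujanCut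

namespace Summit.BirchSwinnertonDyer.Rank1Residual.ManinAdditive.ConwayNortonThree

open scoped Classical

/-- `ζ₃ = e^{2πi/3}`. [folklore] -/
def zeta3 : ℂ := Complex.exp (2 * Real.pi * Complex.I / 3)

variable (N : ℕ) [NeZero N] (k : ℤ)

/-- The translation `t_{j/3} : f ↦ f(z + j/3)` on `S_k(Γ₀(N))` for `9 ∣ N` (an automorphism of `X₀(N)` defined over
`ℚ(ζ₃)`; on `q`-expansions `aₙ ↦ ζ₃^{jn} aₙ`).  Typed like `RamanujanCut.ramanujanThree`: `9^{1−k/2}` times the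
double-coset operator of `thirdTranslateGL j` (a single coset when `9 ∣ N`).  Junk if `9 ∤ N`.
[cite: AtkinLehner1970, §4 (normaliser of Γ₀(N))] -/
def thirdTranslate (j : ℕ) : CuspForm (Gamma0 N) k →ₗ[ℂ] CuspForm (Gamma0 N) k :=
  (((9 : ℝ) ^ (1 - (k : ℝ) / 2) : ℝ) : ℂ) • cuspHeckeOperatorₗ (Gamma0 N) k (thirdTranslateGL j)

/-- The **twist component** `B₃ := (t_{1/3} − t_{2/3})/(ζ₃ − ζ₃²)` of the translation: on `q`-expansions
`aₙ ↦ χ₋₃(n) aₙ` (`χ₋₃(n) = 0, 1, −1` for `n ≡ 0, 1, 2 mod 3`), i.e. `B₃ f = f ⊗ χ₋₃` coefficientwise. [folklore] -/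
def twistOperatorAtThree : CuspForm (Gamma0 N) k →ₗ[ℂ] CuspForm (Gamma0 N) k :=
  (zeta3 - zeta3 ^ 2)⁻¹ • (thirdTranslate N k 1 - thirdTranslate N k 2)

/-- The **diagonal component** `A₃ := t_{1/3} − ζ₃ B₃`: on `q`-expansions `aₙ ↦ aₙ, 0, −aₙ` for
`n ≡ 0, 1, 2 (mod 3)`.  `t_{1/3} = A₃ + ζ₃ B₃`, `R₃ = t_{1/3} + t_{2/3} = 2A₃ − B₃`, `A₃ B₃ = B₃ A₃`,
`A₃³ = A₃`, `B₃³ = B₃` (engine-certified at every level run). [folklore] -/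
def diagonalOperatorAtThree : CuspForm (Gamma0 N) k →ₗ[ℂ] CuspForm (Gamma0 N) k :=
  thirdTranslate N k 1 - zeta3 • twistOperatorAtThree N k

variable {N k}

/-- `S + ζ₃ S`: the `ℤ[ζ₃]`-span of a `ℤ`-lattice of cusp forms (its base change to the Eisenstein integers,
realised inside the complex vector space). [folklore] -/
def eisensteinSpan (S : Submodule ℤ (CuspForm (Gamma0 N) 2)) : Submodule ℤ (CuspForm (Gamma0 N) 2) :=
  S ⊔ S.map ((zeta3 • LinearMap.id : CuspForm (Gamma0 N) 2 →ₗ[ℂ] CuspForm (Gamma0 N) 2).restrictScalars ℤ)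

variable (N) in
/-- **The Conway–Norton lattice at 3**, `M^G(N)`: the largest `ℤ[ζ₃]`-submodule of `S₂(Γ₀(N);ℤ) ⊗ ℤ[ζ₃]`
(= `eisensteinSpan (integralCuspForms0 N 2)`) stable under every Atkin–Lehner involution `w_{Q_p}` and under the
translation `t_{1/3}` — i.e. under the group `G = ⟨t_{1/3}, w_Q⟩ ⊂ Aut X₀(N)_{ℚ(ζ₃)}` (`9 ∣ N`).  All generators are
automorphisms, so this `sSup` has finite index in `S ⊗ ℤ[ζ₃]` (contrast `translationStableLatticeAtThree`).
E-blind and computable (engine `conway_ms_t.py`, OCUT).  By the Néron mapping property over `O = ℤ₃[ζ₃]` and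
`q`-expansion integrality at `∞`, `H⁰(𝒥₀(N)_O, Ω¹) ⊆ M^G ⊗ O` (MEMO-desc §25.4; printed ingredients only). [folklore] -/
def conwayNortonLatticeAtThree : Submodule ℤ (CuspForm (Gamma0 N) 2) :=
  sSup {M | M ≤ eisensteinSpan (integralCuspForms0 N 2) ∧
    M.map ((zeta3 • LinearMap.id : CuspForm (Gamma0 N) 2 →ₗ[ℂ] CuspForm (Gamma0 N) 2).restrictScalars ℤ) ≤ M ∧
    (∀ p : ℕ, p.Prime → p ∣ N → M.map ((atkinLehnerInvolutionAt N 2 p).restrictScalars ℤ) ≤ M) ∧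
    M.map ((thirdTranslate N 2 1).restrictScalars ℤ) ≤ M}

variable (N) in
/-- **The translation-stable lattice at 3**, `S^T(N)`: the largest sublattice of `S₂(Γ₀(N);ℤ)` stable under every
`w_{Q_p}` and under BOTH components `A₃`, `B₃` of `t_{1/3}` (equivalently: `S^T ⊗ ℤ[ζ₃]` is `G`-stable).  `S^T ≤ S^R`
(`R₃ = 2A₃ − B₃`).  WARNING (census): a finite-index such lattice exists at every `27 ∣ N ≤ 567` run (17 levels,
`[S^R : S^T] = 3^{(dim+1)/2…}`), but NOT at `N = 99` (`9 ∥ N`: the iteration shrinks by `3²` for ever — the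
`ℤ`-algebra generated by `A₃, B₃, w₉` is not an order); there this `sSup` has infinite index and `lineIndex` on it is
junk `0`.  Not a cut for the Néron lattice (MEMO-desc §25.5): a proof device for twist invariance. [folklore] -/
def translationStableLatticeAtThree : Submodule ℤ (CuspForm (Gamma0 N) 2) :=
  sSup {M | M ≤ integralCuspForms0 N 2 ∧
    (∀ p : ℕ, p.Prime → p ∣ N → M.map ((atkinLehnerInvolutionAt N 2 p).restrictScalars ℤ) ≤ M) ∧
    M.map ((diagonalOperatorAtThree N 2).restrictScalars ℤ) ≤ M ∧
    M.map ((twistOperatorAtThree N 2).restrictScalars ℤ) ≤ M}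

/-- `S^T ≤ S₂(Γ₀(N);ℤ)`. [folklore] -/
theorem translationStableLatticeAtThree_le : translationStableLatticeAtThree N ≤ integralCuspForms0 N 2 :=
  sSup_le fun _ hM => hM.1

/-- The **plane index** `#(M ⧸ (ℤ f + ℤ ζ₃ f + M ∩ f^⊥))` of a `ℤ[ζ₃]`-lattice `M` along `f` (`f^⊥` = Petersson =
Hecke complement; junk `0` for an infinite quotient).  Writing `e_f M = 𝔞·f` and `M ∩ ℂ f = 𝔟·f` (fractional
`ℤ[ζ₃]`-ideals), this is `[𝔞 : 𝔟 ∩ ℤ[ζ₃]]`, i.e. the INTRINSIC cut-versus-projection index `[e_f M : M ∩ ℂf]` as soon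
as `𝔟 ⊆ ℤ[ζ₃]` (automatic for `M ≤ S₂(Γ₀(N);ℤ) ⊗ ℤ[ζ₃]` and `f` with `a₁ = 1`); it does NOT presuppose `f ∈ M`
(MEMO-desc §25.4 (c): `f ∉ M^G`, `√−3·f ∈ M^G` for the 54 optimal newforms of type I₀*/Iₙ*, whose `χ₋₃`-twist drops level).  For
`M = M^G(N)` and an optimal newform `f` it is `r₀(f)² · 3^{k(f)}` with `r₀(f)` = the prime-to-3 part of the Ramanujan
index `r_R(f)` (engine: `r0sq_ok` and `r0 = r_R'` on 140/140 rows). [folklore] -/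
def planeIndex (M : Submodule ℤ (CuspForm (Gamma0 N) 2)) (f : CuspForm (Gamma0 N) 2) : ℕ :=
  Nat.card (M ⧸ (((ℤ ∙ f) ⊔ (ℤ ∙ (zeta3 • f))) ⊔
    (M ⊓ (LinearMap.ker (peterssonProductₗ (Gamma0 N) 2 f)).restrictScalars ℤ)).comap M.subtype)

/-- The `(√−3)`-adic **Eisenstein depth** `k(f) := ord₃ [e_f M : ℤ[ζ₃] f]` of the `f`-plane of `M`. [folklore] -/
def eisensteinDepth (M : Submodule ℤ (CuspForm (Gamma0 N) 2)) (f : CuspForm (Gamma0 N) 2) : ℕ :=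
  padicValNat 3 (planeIndex M f)

/-! ### Theorem targets (E-blind; paper proofs in MEMO-desc §25.3, not formalised) -/

/-- **Support target `TwistOperatorEqCharTwist`** (E-blind, `q`-expansion bookkeeping): for `9 ∣ N` and the primitive
quadratic character `χ` mod `3`, `B₃ f = f ⊗ χ` for every `f ∈ S₂(Γ₀(N))`.  Proof: compare `q`-expansions
(`ζ₃ⁿ − ζ₃^{2n} = (ζ₃ − ζ₃²) χ₋₃(n)`; `cuspCoeff_charTwist`). 
Refuter-1 §R64: SUPPORT SURVIVES, VALID on paper modulo normalisation (identity `ζ₃ⁿ − ζ₃²ⁿ = (ζ₃ − ζ₃²)χ₋₃(n)` = RB72.5;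
what remains is bookkeeping against `thirdTranslate`'s `9^{1−k/2}` scalar and the slash normalisation) — to be LANDED
FIRST as a theorem (a₁/aₙ identity via `cuspCoeff_charTwist`, §R64 R-2).  desc g8 VERBATIM (Sketch-desc-g8 :125).
[cite: AtkinLehner1970, §4 (normaliser of Γ₀(N); the operator identity is elementary q-expansion bookkeeping, the cell's E-desc-51′)] -/
@[conjecture]
def TwistOperatorEqCharTwist : Prop :=
  ∀ (N : ℕ) [NeZero N] (h9 : 3 ^ 2 ∣ N) (χ : DirichletCharacter ℂ 3) (hχ : χ.IsQuadratic), χ.IsPrimitive →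
    ∀ f : CuspForm (Gamma0 N) 2, twistOperatorAtThree N 2 f = charTwist N dvd_rfl h9 hχ f

/-- **Theorem target E-desc-52 `EisensteinDepthTwistLipschitz`** (E-blind; beyond print as a statement about the
Conway–Norton lattice, elementary as a proof): for `9 ∣ N` and newforms `f`, `f ⊗ χ₋₃` BOTH of level `N`, the
`f`-planes of `M^G(N)` have EQUAL prime-to-3 index and `(√−3)`-depths differing by AT MOST ONE:
`r₀(f) = r₀(f ⊗ χ₋₃)`, `|k(f) − k(f ⊗ χ₋₃)| ≤ 1`.  Proof (§25.3): `D := t_{1/3} − t_{2/3} ∈ ℤ[G]` maps `M^G` into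
itself, anticommutes through the Hecke algebra prime to `3` (`T_n D = χ₋₃(n) D T_n`), hence `e_{f⊗χ} D = D e_f`, and
`D f = (ζ₃ − ζ₃²)·(f ⊗ χ₋₃)` with `(ζ₃ − ζ₃²) = √−3`; apply twice (`D² = R₃ − 2 = −3` on `3`-depleted newforms).
Census (engine OCUT, intrinsic index, 43 levels `9 ∣ N ≤ 459`, HOME/desc/g8/out/pairstats.txt): 74 directed same-level
pairs of optimal newforms — `r₀` equal 74/74, `Δk = 0` on 44, `|Δk| = 1` on 30, `|Δk| ≥ 2` on 0 (e.g. 54a1 `k=1` /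
54b1 `k=0`, 324b1 `3` / 324d1 `4`, 378g1 `2` / 378h1 `1`). 
Refuter-1 §R64: THEOREM TARGET VALID on paper (typed over `M^G = conwayNortonLatticeAtThree N` with `f`, `f ⊗ χ` both
`IsNewform0` at level `N`; norm-shape `n_O(f) = r₀² · 3^k` uses conj-invariance of `M^G`, H-5); land after E-desc-51′ and
E-desc-54 (§R64 R-2).  desc g8 VERBATIM (Sketch-desc-g8 :139).
[cite: AtkinLehner1970, §4 (normaliser; shape only — the Lipschitz row is the cell's E-desc-52, NOT in print; presearch §R64: none)] -/
@[conjecture]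
def EisensteinDepthTwistLipschitz : Prop :=
  ∀ (N : ℕ) [NeZero N] (h9 : 3 ^ 2 ∣ N) (χ : DirichletCharacter ℂ 3) (hχ : χ.IsQuadratic), χ.IsPrimitive →
    ∀ f : CuspForm (Gamma0 N) 2, IsNewform0 f → IsNewform0 (charTwist N dvd_rfl h9 hχ f) →
      planeIndex (conwayNortonLatticeAtThree N) f /
          3 ^ eisensteinDepth (conwayNortonLatticeAtThree N) f =
        planeIndex (conwayNortonLatticeAtThree N) (charTwist N dvd_rfl h9 hχ f) /
          3 ^ eisensteinDepth (conwayNortonLatticeAtThree N) (charTwist N dvd_rfl h9 hχ f) ∧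
      ((eisensteinDepth (conwayNortonLatticeAtThree N) f : ℤ) -
          eisensteinDepth (conwayNortonLatticeAtThree N) (charTwist N dvd_rfl h9 hχ f)).natAbs ≤ 1

/-- **Theorem target E-desc-54 `TranslationStableIndexTwistInvariance`** (E-blind): where the translation-stable
lattice `S^T(N)` has finite index (every `27 ∣ N` run), its `f`-line index is EXACTLY invariant under the same-level
`χ₋₃`-twist of newforms: `[e_f S^T : ℤ f] = [e_{f⊗χ} S^T : ℤ (f ⊗ χ)]`.  Proof: `B₃ S^T ⊆ S^T`, `B₃ e_f = e_{f⊗χ} B₃`,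
`B₃ f = f ⊗ χ`, `B₃ (f ⊗ χ) = f` (newforms of level `9 ∣ N` are `3`-depleted), and `f, f ⊗ χ ∈ S^T` (the lattice
`ℤ(f+f')/2 ⊕ ℤ(f−f')/2` is stable).  Census (TCUT, all 17 levels `27 ∣ N ≤ 567` run, HOME/desc/g8/out/pairstats.txt):
60/60 directed same-level pairs equal, e.g. 54a1/54b1 `2 = 2`, 270a1/270c1 `12 = 12`, 459f1/459c1 `18 = 18`, 216 `8 = 8`,
378g1/378h1 `140 = 140` — including the three residual pairs on which `r_R` is NOT invariant.  (At `9 ∥ N` both sides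
are the junk `0`.) 
Refuter-1 §R64: THEOREM TARGET VALID on paper UNCONDITIONALLY (incl. the `9 ∥ N` junk case: `S^T` is `B₃`-stable,
RB72.7; `f, f′ ∈ S^T`; `B₃` an involution on the plane); land second (§R64 R-2).  desc g8 VERBATIM (Sketch-desc-g8 :158).
[cite: AtkinLehner1970, §4 (normaliser; shape only — the invariance row is the cell's E-desc-54, NOT in print; presearch §R64: none)] -/
@[conjecture]
def TranslationStableIndexTwistInvariance : Prop :=
  ∀ (N : ℕ) [NeZero N] (h9 : 3 ^ 2 ∣ N) (χ : DirichletCharacter ℂ 3) (hχ : χ.IsQuadratic), χ.IsPrimitive →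
    ∀ f : CuspForm (Gamma0 N) 2, IsNewform0 f → IsNewform0 (charTwist N dvd_rfl h9 hχ f) →
      lineIndex (translationStableLatticeAtThree N) f =
        lineIndex (translationStableLatticeAtThree N) (charTwist N dvd_rfl h9 hχ f)

/-! ### Laws (census-backed, `@[conjecture]`, nothing asserted) -/

/-- **Candidate E-desc-51 `RamanujanIndexTwistRigidityAtThree`** (cell bsd-f2-manin, desc g8 MEMO-desc §25; nothing
asserted; census HOME/desc/g8/out/tw3.out: ALL 66 unordered same-level `χ₋₃`-twist pairs of optimal newforms with
`9 ∣ N ≤ 612`): the Ramanujan `f`-line index `r_R(f) = [e_f S^R : ℤ f]` of `RamanujanCut.ramanujanStableLattice` is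
TWIST-RIGID: prime-to-3 parts equal (66/66) and `|ord₃ r_R(f) − ord₃ r_R(f ⊗ χ₋₃)| ≤ 1` (66/66; `= 0` in 62 pairs,
`= 1` in exactly the four pairs 54a1/54b1, 270a1/270c1, 459f1/459c1, 594c1/594h1 — each a rank-0 member of the
residual class «big star at 3 with rational 3-torsion» twisted to a small-type curve, `r_R = deg φ` on both sides).
Typed E-blindly over newforms (the census covers the rational ones).  Why it might fail: a same-level pair at
`3⁴ ∣ N` or `3⁵ ∣ N` (few rows ≤ 612) where `S^R` loses two `3`-steps along one line; `r_R` is NOT the index of a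
`B₃`-stable lattice (`S^R` is `B₃`-unstable at every level run), so only E-desc-52/54 protect it.
[cite: AtkinLehner1970, §4 (normaliser; shape only — the rigidity row is the cell's E-desc-51, NOT in print)] -/
@[conjecture]
def RamanujanIndexTwistRigidityAtThree : Prop :=
  ∀ (N : ℕ) [NeZero N] (h9 : 3 ^ 2 ∣ N) (χ : DirichletCharacter ℂ 3) (hχ : χ.IsQuadratic), χ.IsPrimitive →
    ∀ f : CuspForm (Gamma0 N) 2, IsNewform0 f → IsNewform0 (charTwist N dvd_rfl h9 hχ f) →
      lineIndex (ramanujanStableLattice N) f / 3 ^ padicValNat 3 (lineIndex (ramanujanStableLattice N) f) =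
        lineIndex (ramanujanStableLattice N) (charTwist N dvd_rfl h9 hχ f) /
          3 ^ padicValNat 3 (lineIndex (ramanujanStableLattice N) (charTwist N dvd_rfl h9 hχ f)) ∧
      ((padicValNat 3 (lineIndex (ramanujanStableLattice N) f) : ℤ) -
          padicValNat 3 (lineIndex (ramanujanStableLattice N) (charTwist N dvd_rfl h9 hχ f))).natAbs ≤ 1

/-- **Candidate E-desc-53 `RamanujanTwistJumpResidualLaw`** (cell bsd-f2-manin, desc g8 MEMO-desc §25; nothing asserted;
THIN: 4 jump pairs + 62 rigid pairs at `9 ∣ N ≤ 612`): the Ramanujan index JUMPS under a same-level `χ₋₃`-twist of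
optimal curves exactly on the rank-0 residual class — for optimal `W` (big star at 3, rational 3-torsion, rank 0) with
same-level twist-partner datum `D′` (`D′.f = D.f ⊗ χ₋₃`): `ord₃ r_R(D.f) = ord₃ r_R(D′.f) + 1`.  E-facing
complement of E-desc-51 (which bounds the jump by one); consistent with E-desc-45 (`ResidualRankDefectLawAtThree`)
and the E-an-5 degree jump.  Why it might fail: a rank-0 residual curve at `N > 612` whose partner is itself
big-star (equal-type pairs II*/II* have ratio 1 and no jump at 432). [cite: AgasheRibetStein2012, §2.1 (shape
only: twin pairs; the jump row is the cell's E-desc-53, NOT in print)] -/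
@[conjecture]
def RamanujanTwistJumpResidualLaw : Prop :=
  ∀ (W : WeierstrassCurve ℚ) [W.IsElliptic] [W.IsGloballyMinimal] [NeZero (W.conductorNorm ℤ)]
    (D : ModularParametrizationData W (W.conductorNorm ℤ)),
    (∀ z ∈ D.L.lattice, ∃ w ∈ periodLattice D.f, z = D.c * w) →
    (∀ (W₁ : WeierstrassCurve ℚ) [W₁.IsElliptic]
        (D₁ : ModularParametrizationData W₁ (W.conductorNorm ℤ)),
        D₁.f = D.f → D.modularDegree ≤ D₁.modularDegree) →
    ∀ (h9 : 3 ^ 2 ∣ W.conductorNorm ℤ) (χ : DirichletCharacter ℂ 3) (hχ : χ.IsQuadratic), χ.IsPrimitive →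
    ∀ (W' : WeierstrassCurve ℚ) [W'.IsElliptic] (D' : ModularParametrizationData W' (W.conductorNorm ℤ)),
      D'.f = charTwist (W.conductorNorm ℤ) dvd_rfl h9 hχ D.f →
      IsBigStarAtThree W → HasRationalThreeTorsion W → ¬ HasPointOfInfiniteOrder W →
        padicValNat 3 (lineIndex (ramanujanStableLattice (W.conductorNorm ℤ)) D.f) =
          padicValNat 3 (lineIndex (ramanujanStableLattice (W.conductorNorm ℤ)) D'.f) + 1

/-- Kodaira type at `3` is STARRED (I₀*, Iₙ*, IV*, III*, II*): additive at `3` with at least five components on the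
minimal regular model, `v₃(Δ) ≥ v₃(N) + 4` on a globally minimal model (Ogg: `m = v₃(Δ) + 1 − v₃(N) ≥ 5`).
Contrast `RamanujanCut.IsBigStarAtThree` (`≥ 7` components AND potentially good).  desc g8 census (bcshift3.txt,
Tate rescaling over `ℤ₃[ζ₃]`, 257/257 optimal curves with `9 ∣ N ≤ 612`): STARRED ⟺ the minimal model LOSES
minimality over the ramified quadratic extension `ℚ₃(ζ₃)` (Néron differential shift `s₃(W) = 1`), unstarred
(II, III, IV) ⟺ it stays minimal (`s₃ = 0`).  So `IsStarredAtThree` is the E-facing name of the base-change shift. [folklore] -/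
def IsStarredAtThree (W : WeierstrassCurve ℚ) : Prop :=
  2 ≤ padicValNat 3 (W.conductorNorm ℤ) ∧
    ((padicValNat 3 (W.conductorNorm ℤ) + 4 : ℕ) : ℤ) ≤ padicValRat 3 W.Δ

/-- Kodaira type IV or IV* at `3` — the additive types whose geometric component group has order `3`: POTENTIALLY
GOOD reduction (`c₄ = 0 ∨ v₃(Δ) ≤ 3 v₃(c₄)`, i.e. `v₃(j) ≥ 0` — the clause of `RamanujanCut.IsBigStarAtThree` VERBATIM)
with `m = 3` or `m = 7` components: `v₃(Δ) = v₃(N) + 2` or `v₃(Δ) = v₃(N) + 6` on a globally minimal model.  REPAIR H-1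
(refuter-1 §R64, HOME/ref1/R64-ref1-desc-g7g8.md 47945fc54b95c773): desc g8's sketch (Sketch-desc-g8 62bec9a36a8efd40
:221) omitted the potentially-good clause, so Kodaira I₂* at `9 ∥ N` (`v₃Δ = 8 = v₃N + 6`, potentially multiplicative;
14 optimal curves `≤ 612`: 63a1 … 603d1) satisfied it and E-desc-55 silently dropped those rows; with the clause the
predicate is exactly «component group of order `3`» and E-desc-55 covers the Iₙ* rows its 115 / 115 census counts
(re-tally of the 12 I₂* rows `≤ 459` asked of desc, §R64 R-1). [folklore] -/
def HasThreeComponentsAtThree (W : WeierstrassCurve ℚ) : Prop :=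
  (W.c₄ = 0 ∨ padicValRat 3 W.Δ ≤ 3 * padicValRat 3 W.c₄) ∧
    (padicValRat 3 W.Δ = ((padicValNat 3 (W.conductorNorm ℤ) + 2 : ℕ) : ℤ) ∨
      padicValRat 3 W.Δ = ((padicValNat 3 (W.conductorNorm ℤ) + 6 : ℕ) : ℤ))

/-- **Candidate E-desc-55 `EisensteinHalfStepLaw`** (cell bsd-f2-manin, desc g8 MEMO-desc §25; nothing asserted;
census HOME/desc/g8/out/pairstats.txt, intrinsic index: the 115 optimal newforms of Kodaira type II (29), III (17),
I₀*/Iₙ* (54), III* (7), II* (8) at `3` on the 43 levels `9 ∣ N ≤ 459` run, 115/115): OFF the two Kodaira types whose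
component group has order `3` (IV, IV*), the Conway–Norton plane of an optimal newform loses NO half-step against the
Ramanujan line: `k(f) = 2·ord₃ r_R(f)` exactly (so, with E-desc-42/43, `k = 2 ord₃ deg φ` on II/III/I₀*/Iₙ* and
`k = 2 ord₃ deg φ − 2` on III*/II*).  On IV the half-step is lost on 12 of 14 rows (not 162c1, 243b1), on IV* exactly
on the 3 residual stars — so `η` is an E-BLIND detector of the §23 residual class inside IV* (3 : 8, thin).  Why it
might fail: an Iₙ* curve at `27 ∣ N` does not exist, but a II* curve at `v₃(N) = 5` (none below 486) could keep a
half-step, as the IV ambiguity shows the component group is not the whole story. [cite: AtkinLehner1970, §4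
(normaliser; shape only — the row is the cell's E-desc-55, NOT in print)] -/
@[conjecture]
def EisensteinHalfStepLaw : Prop :=
  ∀ (W : WeierstrassCurve ℚ) [W.IsElliptic] [W.IsGloballyMinimal] [NeZero (W.conductorNorm ℤ)]
    (D : ModularParametrizationData W (W.conductorNorm ℤ)),
    (∀ z ∈ D.L.lattice, ∃ w ∈ periodLattice D.f, z = D.c * w) →
    (∀ (W₁ : WeierstrassCurve ℚ) [W₁.IsElliptic]
        (D₁ : ModularParametrizationData W₁ (W.conductorNorm ℤ)),
        D₁.f = D.f → D.modularDegree ≤ D₁.modularDegree) →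
    3 ^ 2 ∣ W.conductorNorm ℤ → ¬ HasThreeComponentsAtThree W →
      eisensteinDepth (conwayNortonLatticeAtThree (W.conductorNorm ℤ)) D.f =
        2 * padicValNat 3 (lineIndex (ramanujanStableLattice (W.conductorNorm ℤ)) D.f)

/-- **Candidate E-desc-56 `EisensteinHalfStepBound`** (cell bsd-f2-manin, desc g8 MEMO-desc §25; nothing asserted;
E-blind; census HOME/desc/g8/out/pairstats.txt, intrinsic index, 140/140 optimal newforms on 43 levels `9 ∣ N ≤ 459`, all
Kodaira types): the `(√−3)`-adic plane defect of the Conway–Norton lattice is the DOUBLED Ramanujan depth up to ONE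
half-step, never more and never the other way: `2 ord₃ r_R(f) − 1 ≤ k(f) ≤ 2 ord₃ r_R(f)`; the half-step
`η(f) := 2 ord₃ r_R(f) − k(f) = 1` occurs on exactly 15 rows, all of Kodaira type IV (12 of the 14 IV rows) or IV* with
a rational `3`-torsion point and rank `0` (54a1, 270a1, 459f1 — the residual stars of E-desc-45; the 8 other IV* rows
have `η = 0`), see E-desc-55.  Also `r₀(f)` = prime-to-3 part of `r_R(f)` on 140/140.  (Neither bound is formal:
`M^G` need not be comparable with `S^R ⊗ ℤ[ζ₃]`.)  Why it might fail: a level where the largest `⟨t, ζ₃, w_Q⟩`-stable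
`ℤ[ζ₃]`-lattice exceeds `S^R ⊗ ℤ[ζ₃]` along an optimal plane by a full `3`-step. [cite: AtkinLehner1970, §4
(shape only; the row is the cell's E-desc-56, NOT in print)] -/
@[conjecture]
def EisensteinHalfStepBound : Prop :=
  ∀ (W : WeierstrassCurve ℚ) [W.IsElliptic] [W.IsGloballyMinimal] [NeZero (W.conductorNorm ℤ)]
    (D : ModularParametrizationData W (W.conductorNorm ℤ)),
    (∀ z ∈ D.L.lattice, ∃ w ∈ periodLattice D.f, z = D.c * w) →
    (∀ (W₁ : WeierstrassCurve ℚ) [W₁.IsElliptic]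
        (D₁ : ModularParametrizationData W₁ (W.conductorNorm ℤ)),
        D₁.f = D.f → D.modularDegree ≤ D₁.modularDegree) →
    3 ^ 2 ∣ W.conductorNorm ℤ →
      eisensteinDepth (conwayNortonLatticeAtThree (W.conductorNorm ℤ)) D.f ≤
          2 * padicValNat 3 (lineIndex (ramanujanStableLattice (W.conductorNorm ℤ)) D.f) ∧
        2 * padicValNat 3 (lineIndex (ramanujanStableLattice (W.conductorNorm ℤ)) D.f) ≤
          eisensteinDepth (conwayNortonLatticeAtThree (W.conductorNorm ℤ)) D.f + 1

/-- **Candidate E-desc-57 `TranslationStableLatticeDichotomy`** (cell bsd-f2-manin, desc g8 MEMO-desc §25; nothing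
asserted; E-blind; census g8/out TCUT3 lines, 43 levels `9 ∣ N ≤ 567` (H-2 count corrected per refuter-1 §R64): a finite-index `⟨w_Q, A₃, B₃⟩`-stable `ℤ`-lattice
EXISTS at every level with `27 ∣ N` run (54, 108, 135, 162, 189, 216, 243, 270, 297, 324, 351, 378, 405, 432, 459, 513,
567: 17/17, index `[S^R : S^T]` always a power of `3` (`3¹ … 3³³`), reached in ≤ 3 sweeps) and at NO level with `9 ∥ N` and `dim S₂ ≥ 3` run
(45, 63, 72, 90, 99, 117, 126, 144, 153, 171, 180, 198, 207, 225, 234, 252, 261, 279, 288, 306, 315, 333, 369, 387, 423, 441: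
0/26 — the descent `L ↦ L ∩ A₃⁻¹L ∩ B₃⁻¹L ∩ …` loses index `9` at every one of 25 sweeps); OUT-OF-SAMPLE (refuter-1 §R64 U3,
desc's TCUT engine run by the refuter): `N = 81` finite with `[S^R : S^T] = 3`, `N = 477` none — both as predicted; the one-dimensional level `36`
(CM by `ℤ[ζ₃]`, `B₃ f = f`) is the degenerate exception.  At `p = 2` there is NO dichotomy: the analogous
`⟨w_Q, t_{1/2}, A₄, B₄⟩`-stable lattice has finite index at all 25 levels `16 ∣ N ≤ 432` run (and its line index is `χ₋₄`-twist-invariant on 40/40 directed same-level pairs, while `r_G` is not: 38/40).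
Both `A₃` and `B₃` preserve `S₂(Γ₀(N), ℤ)` as soon as `9 ∣ N` (`B₃ = charTwist`), so the obstruction at `9 ∥ N` is the
interaction with the Atkin–Lehner involution at `3`.  Why it might fail: a level `9 ∥ N` whose new part is entirely
CM by `ℚ(√−3)`, or a level `27 ∣ N` beyond `432` where `w_{27}`-conjugated twisting acquires a denominator.
[cite: AtkinLehner1970, §4 (normaliser of Γ₀(N); the dichotomy row is the cell's E-desc-57, NOT in print)] -/
@[conjecture]
def TranslationStableLatticeDichotomy : Prop :=
  ∀ (N : ℕ) [NeZero N], 3 ^ 2 ∣ N → 2 ≤ Module.finrank ℂ (CuspForm (Gamma0 N) 2) →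
    (Finite ((integralCuspForms0 N 2) ⧸
        (translationStableLatticeAtThree N).comap (integralCuspForms0 N 2).subtype) ↔ 3 ^ 3 ∣ N)

end Summit.BirchSwinnertonDyer.Rank1Residual.ManinAdditive.ConwayNortonThree
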